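import Summits.KontsevichZagierPeriods.Zeta5Search.RVFlatGaugeBeyondM1Lemmas
import HarnessLib.Audit
import HarnessLib

/-!
# RVFlatGaugeWindowLemmas — bookkeeping for the window theorem of the FLAT `S₇`-gauge law (fam-rv gen 7, file 1/2)

HONEST FRAMING: systematic search; no irrationality claim unless certified.  Pure bookkeeping over the tree's
definitions (`forms28`, `m1`, `m5`, `eD`, `m5flat`, `eDflat`, `rhoB`, `pairFloors`, `scheme`); no statement minted by
this cell is used or cited as fact here.  Consumed by `RVFlatGaugeWindow.lean` (file 2/2), which proves the flat
`S₇`-gauge law (28)–(30) on the "one long block" window.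

CONTENTS (all PROVED, no placeholders; namespace `…RVFlatGauge.Window`; no declaration name or statement is shared with any tree
file — the generic bookkeeping already landed by fam-rv gen-6 (`RVFlatGaugeBeyondM1Lemmas`: `padicValNat_factorial_of_lt_sq`,
`le_foldr_max_of_mem`, `single_le_m1`, `pair_le_m1`, `epairs_range`) is IMPORTED, not re-proved):
* `padicValNat_prod_map`, `two_le_countP`;
* `T4 p s := Σ ⌊log_p ·⌋` over the first four entries of a list; `one_le_T4` / `two_le_T4`: in a `≥`-sorted list one
  (two) entries `≥ p` charge one (two) units to `T4`; `eD_eq_T4_add` / `eDflat_eq_T4_add`: `e_D = T4(sorted forms) +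
  ⌊log_p m₅⌋`, `e_D♭ = T4(sorted forms) + ⌊log_p m₅♭⌋`; `one_le_log_m5flat`: `p ≤ ⌊d/2⌋ ⇒ ⌊log_p m₅♭⌋ ≥ 1`;
* pair bookkeeping: `nonE` = the six 0-based pairs `(0,5),(0,6),(1,6),(2,4),(3,4),(3,5)` NOT in gen-1's numerator graph
  `E` (`WedgeDictionary.Epairs`; in 1-based labels `(1,6),(1,7),(2,7),(3,5),(4,5),(4,6)`) — a Hamiltonian PATH
  `2–7–1–6–4–5–3` of `K₇`, so every slot meets at most two of them (`card_nonE_filter_le`, `decide`);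
  `pairFloors_eq_eSum_add`: `N_p(c) = eSum + nonESum`; `idxOf`, `idxOf_mem_scheme`, `idxOf_inj`, `ev_idxOf`: the non-`E`
  pairs as entries of the 28-form scheme `PermutationSavingForms28.scheme` (so a non-`E` form `≥ p` is counted by
  `countP (p ≤ ·) (forms28 c)` via `forms28_eq_scheme`);
* `padicValRat_rhoB_smallParams`: for an odd prime `p`, `c` in the polytope with `c₁,…,c₇ < p`, `c₀ + 2 < p²`,
  `d(c) < p²`:  `v_p ρ(c) = Σ_{(j,k)∈E} ⌊(c₀−c_j−c_k)/p⌋ − ⌊d(c)/p⌋`  (the five `c_i!` in ρ's denominator are `p`-units;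
  same skeleton as the tree's `XSave.padicValRat_rhoOf`);
* `foldr_max_zero_le`, `m1_le_b0_add_one`: `m₁ ≤ b₀ + 1` in the polytope (so the window's `b₀ + 2 < p²` gives the
  conjecture node's `m₁ < p²`).
-/

namespace Summit.KontsevichZagierPeriods.Zeta5Search.RVFlatGauge

open Finset
open Summit.KontsevichZagierPeriods.Zeta5Search.CasoratianValuation (casoratian shift InPolytope pairFloors refund)
open Summit.KontsevichZagierPeriods.Zeta5Search.WedgeDictionary (dOf Epairs)
open Summit.KontsevichZagierPeriods.Zeta5Search.SymmetricGauge
open Summit.KontsevichZagierPeriods.Zeta5Search.DualSeries (InBox)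

namespace Window

/-- Valuation of a product of non-zero naturals indexed by a list. -/
theorem padicValNat_prod_map {α : Type*} (p : ℕ) [hp : Fact p.Prime] (l : List α) (g : α → ℕ)
    (h : ∀ x ∈ l, g x ≠ 0) :
    padicValNat p (l.map g).prod = (l.map fun x => padicValNat p (g x)).sum := by
  induction l with
  | nil => simp
  | cons a t ih =>
    have ha : g a ≠ 0 := h a (by simp)
    have ht : ∀ x ∈ t, g x ≠ 0 := fun x hx => h x (by simp [hx])
    have hpos : 0 < (t.map g).prod := List.prod_pos fun x hx => by
      obtain ⟨y, hy, rfl⟩ := List.mem_map.1 hx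
      exact Nat.pos_of_ne_zero (ht y hy)
    simp only [List.map_cons, List.prod_cons, List.sum_cons]
    rw [padicValNat.mul ha hpos.ne', ih ht]

/-- Two distinct members satisfying `q` force `countP q ≥ 2`. -/
theorem two_le_countP {α : Type*} [DecidableEq α] (l : List α) (q : α → Bool) {a b : α} (hab : a ≠ b)
    (ha : a ∈ l) (hb : b ∈ l) (qa : q a = true) (qb : q b = true) : 2 ≤ l.countP q := by
  rw [List.countP_eq_length_filter]
  have hsub : ({a, b} : Finset α) ⊆ (l.filter q).toFinset := by
    intro x hx
    rw [Finset.mem_insert, Finset.mem_singleton] at hx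
    rw [List.mem_toFinset, List.mem_filter]
    rcases hx with rfl | rfl
    · exact ⟨ha, qa⟩
    · exact ⟨hb, qb⟩
  calc 2 = ({a, b} : Finset α).card := (Finset.card_pair hab).symm
    _ ≤ (l.filter q).toFinset.card := Finset.card_le_card hsub
    _ ≤ (l.filter q).length := List.toFinset_card_le _

/-- The `⌊log_p⌋`-charge of the four largest entries of a (sorted) list. -/
def T4 (p : ℕ) (s : List ℤ) : ℤ := ((s.take 4).map fun m => (Nat.log p m.toNat : ℤ)).sum

/-- `p ≤ m ⇒ ⌊log_p m⌋ ≥ 1`. -/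
theorem one_le_log_of_le {p : ℕ} (hp : 1 < p) {m : ℤ} (h : (p : ℤ) ≤ m) : 1 ≤ (Nat.log p m.toNat : ℤ) := by
  have : p ≤ m.toNat := by omega
  exact_mod_cast Nat.log_pos hp this

/-- `T4 ≥ 0`. -/
theorem T4_nonneg (p : ℕ) (s : List ℤ) : 0 ≤ T4 p s :=
  List.sum_nonneg fun x hx => by
    obtain ⟨m, -, rfl⟩ := List.mem_map.1 hx
    positivity

/-- One entry `≥ p` in a `≥`-sorted list charges at least one unit among the top four. -/
theorem one_le_T4 {p : ℕ} (hp : 1 < p) {s : List ℤ} (hsort : s.Pairwise (· ≥ ·))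
    (hc : 1 ≤ s.countP (fun y => decide ((p : ℤ) ≤ y))) : (1 : ℤ) ≤ T4 p s := by
  rcases s with _ | ⟨a₀, t⟩
  · simp at hc
  · obtain ⟨y, hy, hpy⟩ := List.countP_pos_iff.1 (by omega : 0 < List.countP (fun y => decide ((p : ℤ) ≤ y)) (a₀ :: t))
    simp only [decide_eq_true_eq] at hpy
    have h0 : (p : ℤ) ≤ a₀ := by
      rcases List.mem_cons.1 hy with rfl | hy'
      · exact hpy
      · exact hpy.trans ((List.pairwise_cons.1 hsort).1 y hy')
    have h1 := one_le_log_of_le hp h0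
    have hrest : 0 ≤ ((t.take 3).map fun m => (Nat.log p m.toNat : ℤ)).sum :=
      List.sum_nonneg fun x hx => by
        obtain ⟨m, -, rfl⟩ := List.mem_map.1 hx
        positivity
    simp only [T4, List.take_succ_cons, List.map_cons, List.sum_cons]
    omega

/-- Two entries `≥ p` in a `≥`-sorted list charge at least two units among the top four. -/
theorem two_le_T4 {p : ℕ} (hp : 1 < p) {s : List ℤ} (hsort : s.Pairwise (· ≥ ·))
    (hc : 2 ≤ s.countP (fun y => decide ((p : ℤ) ≤ y))) : (2 : ℤ) ≤ T4 p s := by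
  rcases s with _ | ⟨a₀, _ | ⟨a₁, t⟩⟩
  · simp at hc
  · have h := List.countP_le_length (p := fun y => decide ((p : ℤ) ≤ y)) (l := [a₀])
    simp only [List.length_cons, List.length_nil] at h
    omega
  · rw [List.pairwise_cons] at hsort
    obtain ⟨h0, hsort'⟩ := hsort
    rw [List.pairwise_cons] at hsort'
    obtain ⟨h1, _⟩ := hsort'
    have ha₁ : (p : ℤ) ≤ a₁ := by
      by_contra hlt'
      have hlt : a₁ < (p : ℤ) := not_le.mp hlt'
      have ht0 : t.countP (fun y => decide ((p : ℤ) ≤ y)) = 0 :=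
        List.countP_eq_zero.2 fun y hy => by have := h1 y hy; simp; omega
      simp only [List.countP_cons, ht0, decide_eq_true_eq] at hc
      split_ifs at hc <;> omega
    have ha₀ : (p : ℤ) ≤ a₀ := ha₁.trans (h0 a₁ (by simp))
    have g0 := one_le_log_of_le hp ha₀
    have g1 := one_le_log_of_le hp ha₁
    have hrest : 0 ≤ ((t.take 2).map fun m => (Nat.log p m.toNat : ℤ)).sum :=
      List.sum_nonneg fun x hx => by
        obtain ⟨m, -, rfl⟩ := List.mem_map.1 hx
        positivity
    simp only [T4, List.take_succ_cons, List.map_cons, List.sum_cons]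
    omega

/-- `e_D = T4(sorted forms) + ⌊log_p m₅⌋`: the fifth sorted form is `m₅`. -/
theorem eD_eq_T4_add (c : ℕ → ℤ) (p : ℕ) :
    eD c p = T4 p ((forms28 c).insertionSort (· ≥ ·)) + (Nat.log p (m5 c).toNat : ℤ) := by
  unfold eD m5
  generalize hS : (forms28 c).insertionSort (· ≥ ·) = S
  have hlen : S.length = 28 := by rw [← hS, List.length_insertionSort, forms28_eq]; rfl
  rcases S with _ | ⟨a₀, _ | ⟨a₁, _ | ⟨a₂, _ | ⟨a₃, _ | ⟨a₄, t⟩⟩⟩⟩⟩ <;> simp at hlen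
  simp [T4]
  ring

/-- `e_D♭ = T4(sorted forms) + ⌊log_p m₅♭⌋`. -/
theorem eDflat_eq_T4_add (c : ℕ → ℤ) (p : ℕ) :
    eDflat c p = T4 p ((forms28 c).insertionSort (· ≥ ·)) + (Nat.log p (m5flat c).toNat : ℤ) := by
  unfold eDflat; rw [eD_eq_T4_add]; ring

/-- If `p ≤ ⌊d/2⌋` the flat fifth modulus charges a unit. -/
theorem one_le_log_m5flat {c : ℕ → ℤ} {p : ℕ} (hp : 1 < p) (h : (p : ℤ) ≤ dOf c / 2) :
    1 ≤ (Nat.log p (m5flat c).toNat : ℤ) :=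
  one_le_log_of_le hp (h.trans (le_max_right _ _))

/-! ### Pair bookkeeping: `E` versus the six non-`E` pairs -/

/-- The six pairs of lower slots NOT in gen-1's numerator graph `E` (0-based: slot `k` ↦ `b_{k+1}`); in 1-based labels
`(1,6),(1,7),(2,7),(3,5),(4,5),(4,6)` = the Hamiltonian path `2–7–1–6–4–5–3` of `K₇`, so every slot lies on at most two of them. -/
def nonE : Finset (ℕ × ℕ) := {(0, 5), (0, 6), (1, 6), (2, 4), (3, 4), (3, 5)}

/-- The non-`E` pairs are pairs `j < k` of slots in `{0,…,6}` (`decide`). -/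
theorem nonE_bounds : ∀ x ∈ nonE, x.1 < 7 ∧ x.2 < 7 ∧ x.1 < x.2 := by decide

/-- The path property: a slot lies on at most two non-`E` pairs. -/
theorem card_nonE_filter_le {i : ℕ} (hi : i < 7) : (nonE.filter fun x => x.1 = i ∨ x.2 = i).card ≤ 2 := by
  have h : ∀ i ∈ range 7, (nonE.filter fun x => x.1 = i ∨ x.2 = i).card ≤ 2 := by decide
  exact h i (mem_range.2 hi)

/-- The `E`-part of the 21 pair floors `⌊(c₀−c_j−c_k)/p⌋`. -/
def eSum (c : ℕ → ℤ) (p : ℕ) : ℤ := (Epairs.map fun jk => (c 0 - c jk.1 - c jk.2) / (p : ℤ)).sum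

/-- One pair floor `⌊(c₀ − c_{j+1} − c_{k+1})/p⌋` (0-based pair `x = (j,k)`). -/
def pf (c : ℕ → ℤ) (p : ℕ) (x : ℕ × ℕ) : ℤ := (c 0 - c (x.1 + 1) - c (x.2 + 1)) / (p : ℤ)

/-- The non-`E` part. -/
def nonESum (c : ℕ → ℤ) (p : ℕ) : ℤ := ∑ x ∈ nonE, pf c p x

/-- `N_p(c) = (E-part) + (non-E part)`. -/
theorem pairFloors_eq_eSum_add (c : ℕ → ℤ) (p : ℕ) : pairFloors c p = eSum c p + nonESum c p := by
  simp [pairFloors, eSum, nonESum, pf, nonE, Epairs, Finset.sum_range_succ, Finset.sum_insert]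
  ring

/-- A version-proof `ℕ → Fin 7`. -/
def fin7 (a : ℕ) : Fin 7 := ⟨a % 7, Nat.mod_lt _ (by decide)⟩

/-- The scheme index (`PermutationSavingForms28`) of a 0-based pair. -/
def idxOf (x : ℕ × ℕ) : Idx := Sum.inr s(fin7 x.1, fin7 x.2)

/-- The non-`E` pairs are off-diagonal (`decide`). -/
theorem fin7_ne : ∀ x ∈ nonE, fin7 x.1 ≠ fin7 x.2 := by decide

/-- A non-`E` pair is an entry of the 28-form scheme. -/
theorem idxOf_mem_scheme {x : ℕ × ℕ} (hx : x ∈ nonE) : idxOf x ∈ scheme :=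
  List.mem_append_right _ (List.mem_map.2 ⟨s(fin7 x.1, fin7 x.2),
    (mem_pairIdx_iff _).2 (by rw [Sym2.mk_isDiag_iff]; exact fin7_ne x hx), rfl⟩)

/-- `idxOf` is injective on the non-`E` pairs (`decide`). -/
theorem idxOf_inj : ∀ x ∈ nonE, ∀ y ∈ nonE, idxOf x = idxOf y → x = y := by decide

/-- The scheme evaluates a non-`E` pair to its pair form `c₀ − c_{j+1} − c_{k+1}`. -/
theorem ev_idxOf (c : ℕ → ℤ) : ∀ x ∈ nonE, ev c (idxOf x) = c 0 - c (x.1 + 1) - c (x.2 + 1) := by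
  intro x hx
  simp only [nonE, Finset.mem_insert, Finset.mem_singleton] at hx
  rcases hx with rfl | rfl | rfl | rfl | rfl | rfl <;> simp [idxOf, fin7, ev, Sym2.lift_mk] <;> ring

/-! ### `v_p(ρ(c))` when the seven lower parameters are below `p` -/

/-- **`v_p(ρ(c)) = Σ_{(j,k)∈E} ⌊(c₀−c_j−c_k)/p⌋ − ⌊d(c)/p⌋`** for an odd prime `p` exceeding `c₁,…,c₇`, `c` in the polytope,
`c₀ + 2 < p²`, `d(c) < p²` (Legendre below `p²` on each of gen-1's twenty-one factorials; the five `c_i!` are units). -/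
theorem padicValRat_rhoB_smallParams {c : ℕ → ℤ} (hc : InPolytope c) {p : ℕ} (hp : p.Prime) (hp2 : p ≠ 2)
    (hwin : (c 0 + 2 : ℤ) < (p : ℤ) ^ 2) (hd : dOf c < (p : ℤ) ^ 2) (hsmall : ∀ k ∈ range 7, c (k + 1) < p) :
    padicValRat p (rhoB c) = eSum c p - dOf c / p := by
  haveI : Fact p.Prime := ⟨hp⟩
  obtain ⟨⟨h00, hbox⟩, hhalf, hsum⟩ := hc
  have hnn : ∀ j, 1 ≤ j → j ≤ 7 → 0 ≤ c j ∧ 2 * c j ≤ c 0 ∧ c j < p := by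
    intro j hj1 hj7
    obtain ⟨i, rfl⟩ : ∃ i, j = i + 1 := ⟨j - 1, by omega⟩
    exact ⟨(hbox i (mem_range.2 (by omega))).1, hhalf i (mem_range.2 (by omega)), hsmall i (mem_range.2 (by omega))⟩
  have hd0 : 0 ≤ dOf c := by unfold dOf; linarith
  set N : ℕ := (Epairs.map fun jk => (c 0 - c jk.1 - c jk.2).toNat.factorial).prod with hN
  set M : ℕ := (([1, 4, 5, 6, 7] : List ℕ).map fun j => (c j).toNat.factorial).prod with hM
  set D : ℕ := (dOf c).toNat.factorial with hD
  have hrho : rhoB c = ((-1 : ℚ) ^ (∑ j ∈ range 7, c (j + 1)).toNat * (N : ℚ)) / ((4 * M : ℕ) * (D : ℚ)) := by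
    unfold rhoB
    simp only [hN, hM, hD, Epairs, List.map, List.prod_cons, List.prod_nil]
    push_cast
    ring
  have hNpos : 0 < N := by
    rw [hN]; exact List.prod_pos fun x hx => by
      obtain ⟨jk, -, rfl⟩ := List.mem_map.1 hx; exact Nat.factorial_pos _
  have hMpos : 0 < M := by
    rw [hM]; exact List.prod_pos fun x hx => by
      obtain ⟨j, -, rfl⟩ := List.mem_map.1 hx; exact Nat.factorial_pos _
  have hDpos : 0 < D := Nat.factorial_pos _
  -- valuations of the pieces
  have vN : padicValNat p N = (Epairs.map fun jk => (c 0 - c jk.1 - c jk.2).toNat / p).sum := by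
    rw [hN, padicValNat_prod_map p _ _ (fun jk _ => Nat.factorial_ne_zero _)]
    refine congrArg List.sum (List.map_congr_left fun jk hjk => ?_)
    obtain ⟨h1, h7, h1', h7', _⟩ := epairs_range jk hjk
    obtain ⟨hj0, _, _⟩ := hnn jk.1 h1 h7
    obtain ⟨hk0, _, _⟩ := hnn jk.2 h1' h7'
    apply padicValNat_factorial_of_lt_sq
    have hq : (((c 0 - c jk.1 - c jk.2).toNat : ℕ) : ℤ) < (p : ℤ) ^ 2 := by
      rw [Int.toNat_of_nonneg (by omega)]; omega
    exact_mod_cast hq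
  have vM : padicValNat p (4 * M) = 0 := by
    rw [show 4 * M = ([4] ++ (([1, 4, 5, 6, 7] : List ℕ).map fun j => (c j).toNat.factorial)).prod by
      rw [List.prod_append, hM]; simp]
    refine XSave.padicValNat_list_prod_eq_zero hp _ fun x hx => ?_
    rcases List.mem_append.1 hx with h4 | hx
    · simp only [List.mem_singleton] at h4
      subst h4
      intro h
      have h' : p ∣ 2 ^ 2 := by norm_num at h ⊢; exact h
      have := (Nat.prime_dvd_prime_iff_eq hp Nat.prime_two).1 (hp.dvd_of_dvd_pow h')
      exact hp2 this
    · obtain ⟨j, hj, rfl⟩ := List.mem_map.1 hx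
      rw [hp.dvd_factorial]
      have hj' : 1 ≤ j ∧ j ≤ 7 := by simp only [List.mem_cons, List.mem_nil_iff, or_false] at hj; omega
      have := (hnn j hj'.1 hj'.2).2.2
      have := hp.pos
      omega
  have vD : padicValNat p D = (dOf c).toNat / p := by
    apply padicValNat_factorial_of_lt_sq
    have hq : (((dOf c).toNat : ℕ) : ℤ) < (p : ℤ) ^ 2 := by rw [Int.toNat_of_nonneg hd0]; exact hd
    exact_mod_cast hq
  -- assemble
  have hNq : (N : ℚ) ≠ 0 := by exact_mod_cast hNpos.ne'
  have hsq : ((-1 : ℚ)) ^ (∑ j ∈ range 7, c (j + 1)).toNat ≠ 0 := pow_ne_zero _ (by norm_num)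
  have hnum : ((-1 : ℚ)) ^ (∑ j ∈ range 7, c (j + 1)).toNat * (N : ℚ) ≠ 0 := mul_ne_zero hsq hNq
  have h4M : ((4 * M : ℕ) : ℚ) ≠ 0 := by exact_mod_cast (show 4 * M ≠ 0 by omega)
  have hDq : (D : ℚ) ≠ 0 := by exact_mod_cast hDpos.ne'
  have hden : ((4 * M : ℕ) : ℚ) * (D : ℚ) ≠ 0 := mul_ne_zero h4M hDq
  have v1 : padicValRat p ((-1 : ℚ) ^ (∑ j ∈ range 7, c (j + 1)).toNat) = 0 := by
    rcases neg_one_pow_eq_or ℚ ((∑ j ∈ range 7, c (j + 1)).toNat) with h | h <;>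
      simp [h, padicValRat.neg]
  have hE : (((Epairs.map fun jk => (c 0 - c jk.1 - c jk.2).toNat / p).sum : ℕ) : ℤ) = eSum c p := by
    unfold eSum
    rw [Nat.cast_list_sum, List.map_map]
    refine congrArg List.sum (List.map_congr_left fun jk hjk => ?_)
    obtain ⟨h1, h7, h1', h7', _⟩ := epairs_range jk hjk
    obtain ⟨hj0, hj2, _⟩ := hnn jk.1 h1 h7
    obtain ⟨hk0, hk2, _⟩ := hnn jk.2 h1' h7'
    simp only [Function.comp_apply, Int.natCast_div]
    rw [Int.toNat_of_nonneg (by omega)]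
  have hDc : (((dOf c).toNat / p : ℕ) : ℤ) = dOf c / p := by
    rw [Int.natCast_div, Int.toNat_of_nonneg hd0]
  rw [hrho, padicValRat.div hnum hden, padicValRat.mul hsq hNq, padicValRat.mul h4M hDq, v1,
    padicValRat.of_nat, padicValRat.of_nat, padicValRat.of_nat, vN, vM, vD, hE, hDc]
  push_cast
  ring

/-! ### `m₁ ≤ b₀ + 1` -/

/-- `foldr max 0 ≤ y` when every member and `0` are `≤ y`. -/
theorem foldr_max_zero_le {l : List ℤ} {y : ℤ} (hy : 0 ≤ y) (h : ∀ x ∈ l, x ≤ y) : l.foldr max 0 ≤ y := by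
  induction l with
  | nil => simpa using hy
  | cons a t ih =>
    simp only [List.foldr_cons]
    exact max_le (h a (by simp)) (ih fun x hx => h x (by simp [hx]))

/-- In the polytope every form is `≤ b₀ + 1`, hence `m₁ ≤ b₀ + 1` (so the window's `b₀ + 2 < p²` gives `m₁ < p²`). -/
theorem m1_le_b0_add_one {b : ℕ → ℤ} (hb : InPolytope b) : m1 b ≤ b 0 + 1 := by
  obtain ⟨⟨h0, hbox⟩, _, _⟩ := hb
  apply foldr_max_zero_le (by omega)
  intro x hx
  rw [forms28_eq_scheme] at hx
  obtain ⟨y, -, rfl⟩ := List.mem_map.1 hx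
  cases y with
  | inl i => exact (hbox i.val (mem_range.2 i.isLt)).2
  | inr s =>
    induction s using Sym2.ind with
    | h j k =>
      simp only [ev, Sym2.lift_mk]
      have := (hbox j.val (mem_range.2 j.isLt)).1
      have := (hbox k.val (mem_range.2 k.isLt)).1
      omega

end Window

end Summit.KontsevichZagierPeriods.Zeta5Search.RVFlatGauge
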